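import Summits.ResolutionOfSingularities.ResolutionOfSingularities.Theorems.PurelyInseparableDim4WinCertLeafSound
import Mathlib.FieldTheory.Finite.Basic
import HarnessLib

/-!
# FCert v3 over ANY FINITE COEFFICIENT FIELD `k` («𝔽_q edition»): the cover with `x^{|k|} − x` witnesses and the
# soundness of `lwinCertBL |k| p leafOK` over every field `K ⊇ k` of characteristic `p` (cell `res-dim4-pi`, ∀K column)

[OURS · counted 0 · a certificate format for OUR frame v4, not about resolution] Seat res-dim4-p-8 g4 (width copy; kernel-kit
lineage), after res-dim4-typ-3g9's located need (bus 2026-08-29 01:52:28Z (iii)): the twelve Fermat/cube-type root-blocked roots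
of the (2,2) ∀K column need a flat-absorption BASE CHILD at an `𝔽₄`-point (`b_u = ω`), which a certificate with coefficients in
`ZMod 2` cannot express.  res-rescue-typ-3 g8/g9's checkers (`WinCertFlat.fwinCertBL`, `WinCertLeaf.lwinCertBL p q leafOK`) are
ALREADY generic in the coefficient field `k`; only their SOUNDNESS (`…WinCertLeafSound`) is typed over `ZMod p`, through exactly
one field-specific step — the rationality of a reply coordinate from `b_i^p = b_i` (`WinCertAllFields.exists_eq_cast_of_pow_char_eq`).
This file re-types that soundness chain VERBATIM for a finite field `k` with `Fintype.card k = N`, the checker called as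
`lwinCertBL N p leafOK` (cover witnesses `(x_i^N − x_i)·Π(x_t − c)·Π fac`), along an arbitrary `f : k →+* K`:

* §0 **`exists_eq_of_pow_card_eq`**: `x ^ Fintype.card k = x ⟹ ∃ c, f c = x` (the `|k|` images `f c` are roots of
  `X^{|k|} − X`, which has at most `|k|` roots);
* §1 **`rational_or_onFlat_or_onILeaf_card`** — THE COVER with `N = |k|`: an equimultiple `K`-point of a covered chart is
  `k`-rational (`f ∘ b₀`), or on a flat, or on a leaf;
* §2 `LeafSoundF k p leafOK` (sound leaf oracle along every `f : k →+* K`), `lrowStateF`, `LRowGoodF`;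
* §3 `ledges_of_moveF`, `lrowGood_of_lrowOKF`, `lrowGood_of_lwinCertBLF`, **`forall_inScopeStateWins_of_lwinCertBLF
  (hN : Fintype.card k = N) (hs : LeafSoundF k p leafOK) (h : lwinCertBL N p leafOK T = true) (K) [CharP K p] (f : k →+* K)`**:
  every row state `⊗_f K` is IN-SCOPE ESCAPABLE.  (`k = ZMod p`, `N = p` is res-rescue-typ-3 g9's landed theorem.)
The `𝔽₄` instance (oracle, `Fintype.card F4 = 4`, and the DESCENT to fields of characteristic 2 WITHOUT a cube root of unity
via `AlgebraicClosure` + `StepKit.F4.lift` + res-dim4-p-14's `ScopeSymmetry.inScopeStateWins_of_inScopeStateWins_map`) is the sequel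
`…WinCertLeafSoundF4`.
Nothing here proves resolution of singularities in dimension ≥ 4 / characteristic `p`; F4-C(2,2) stays OPEN; the column this
feeds certifies `InScopeStateWins` on listed roots only.  Counted 0; AI work, weaker than expert review.
bears_on: LADDER-RESOLUTION:D157-DOOR2 (res-dim4-pi · F4-C ∀K column · FCert v3 soundness, 𝔽_q edition).
Supports stmt-ResolutionOfSingularities-16155 (helper).
-/

set_option linter.dupNamespace false -- mandated namespace of this single-conjunct summit

noncomputable section
open MvPolynomial Finset
open scoped BigOperators
namespace Summit.ResolutionOfSingularities.ResolutionOfSingularities.Theorems.PIDim4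

namespace WinCertLeaf

open Literature.AlgebraicGeometry.Resolution
open Literature.AlgebraicGeometry.Resolution.CentreBlowup
open StepKit WinCertSound InScopeWinCert ScopeCover ScopeBlind WinCertAllFields FlatAbsorb WinCertFlat WinCertSubst

/-! ## 0. Rationality along `f : k →+* K` from `x^{|k|} = x` -/

/-- **An element of `K` with `x^{|k|} = x` is in the image of the finite field `k`**: the `|k|` distinct images `f c` are
roots of `X^{|k|} − X` (`c^{|k|} = c` in `k`), and that polynomial has at most `|k|` roots in the field `K`.
[cite: LidlNiederreiter1997, Lemma 2.4 / Thm 2.5 (a^q = a characterises 𝔽_q)] [folklore] -/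
theorem exists_eq_of_pow_card_eq {k K : Type} [Field k] [Fintype k] [Field K] (f : k →+* K) {x : K}
    (hx : x ^ Fintype.card k = x) : ∃ c : k, f c = x := by
  classical
  have h1 : 1 < Fintype.card k := Fintype.one_lt_card
  have hP0 : (Polynomial.X ^ Fintype.card k - Polynomial.X : Polynomial K) ≠ 0 :=
    FiniteField.X_pow_card_sub_X_ne_zero K h1
  have hdeg : (Polynomial.X ^ Fintype.card k - Polynomial.X : Polynomial K).natDegree = Fintype.card k :=
    FiniteField.X_pow_card_sub_X_natDegree_eq K h1
  have hroot : ∀ y : K, y ^ Fintype.card k = y →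
      y ∈ (Polynomial.X ^ Fintype.card k - Polynomial.X : Polynomial K).roots.toFinset := fun y hy => by
    rw [Multiset.mem_toFinset, Polynomial.mem_roots hP0, Polynomial.IsRoot.def, Polynomial.eval_sub, Polynomial.eval_pow,
      Polynomial.eval_X, hy, sub_self]
  have himg : Finset.univ.image f ⊆ (Polynomial.X ^ Fintype.card k - Polynomial.X : Polynomial K).roots.toFinset := by
    intro y hy
    obtain ⟨c, -, rfl⟩ := Finset.mem_image.mp hy
    exact hroot _ (by rw [← map_pow, FiniteField.pow_card])
  have hcard : (Polynomial.X ^ Fintype.card k - Polynomial.X : Polynomial K).roots.toFinset.card ≤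
      (Finset.univ.image f).card := by
    rw [Finset.card_image_of_injective _ f.injective, Finset.card_univ]
    exact (Multiset.toFinset_card_le _).trans ((Polynomial.card_roots' _).trans hdeg.le)
  have hxr := hroot x hx
  rw [← Finset.eq_of_subset_of_card_le himg hcard] at hxr
  obtain ⟨c, -, hc⟩ := Finset.mem_image.mp hxr
  exact ⟨c, hc⟩

/-! ## 1. The cover with `x^{|k|} − x` witnesses -/

variable {C : Type}

/-- **THE COVER, 𝔽_q edition** (`lcoverOKL |k| q`): at a covered chart `j`, every equimultiple `K`-point `b` (`b_j = 0`) is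
`f ∘ b₀` for a `k`-point `b₀` with `b₀ j = 0`, or lies on a flat of the chart, or lies on a leaf of the chart.  Verbatim
res-rescue-typ-3 g9's `rational_or_onFlat_or_onILeaf` with `exists_eq_of_pow_card_eq` for the rational coordinate. [folklore] -/
theorem rational_or_onFlat_or_onILeaf_card {k : Type} [Field k] [Fintype k] [DecidableEq k] {N : ℕ} (hN : Fintype.card k = N)
    {q : ℕ} {K : Type} [Field K] [DecidableEq K] (f : k →+* K) {s : SData 4 k} {S : Finset (Fin 4)} {j : Fin 4}
    {wits : List (LWit k)} {flats : List (Flat k)} {leaves : List (ILeaf k C)}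
    (hcov : lcoverOKL N q s S j wits flats leaves = true)
    (h0 : ∀ φ ∈ flats, φ.b0 φ.j = 0) {b : Fin 4 → K} (hbj : b j = 0)
    (heq : IsEquimultiplePoint q S j b (⟨MvPolynomial.map f s.toState.F, s.toState.r, s.toState.exc⟩ : State K)) :
    (∃ b₀ : Fin 4 → k, b₀ j = 0 ∧ f ∘ b₀ = b) ∨ (∃ φ ∈ flats, φ.j = j ∧ OnFlat f φ b) ∨
      ∃ ℓ ∈ leaves, ℓ.j = j ∧ OnLeaf f ℓ b := by
  classical
  by_cases hflat : ∃ φ ∈ flats, φ.j = j ∧ OnFlat f φ b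
  · exact Or.inr (Or.inl hflat)
  by_cases hleaf : ∃ ℓ ∈ leaves, ℓ.j = j ∧ OnLeaf f ℓ b
  · exact Or.inr (Or.inr hleaf)
  left
  push Not at hflat hleaf
  unfold lcoverOKL at hcov
  have hall := of_decide_eq_true hcov
  set fl := flats.filter fun φ : Flat k => decide (φ.j = j) with hfl
  set lv := leaves.filter fun ℓ : ILeaf k C => decide (ℓ.j = j) with hlv
  have hflj : ∀ φ ∈ fl, φ.j = j := fun φ hφ => of_decide_eq_true (List.mem_filter.mp hφ).2
  have hfl0 : ∀ φ ∈ fl, φ.b0 φ.j = 0 := fun φ hφ => h0 φ (List.mem_filter.mp hφ).1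
  have hnotf : ∀ φ ∈ fl, ¬ OnFlat f φ b := fun φ hφ => hflat φ (List.mem_filter.mp hφ).1 (hflj φ hφ)
  have hnotl : ∀ ℓ ∈ lv, ¬ OnLeaf f ℓ b := fun ℓ hℓ =>
    hleaf ℓ (List.mem_filter.mp hℓ).1 (of_decide_eq_true (List.mem_filter.mp hℓ).2)
  obtain ⟨τ, hτ, hprodτ⟩ := exists_sectionL_of_forall_not_onFlat f hbj fl hflj hfl0 hnotf
  obtain ⟨ρ, hρ, hρall⟩ := exists_section_of_forall_not_onILeaf f lv hnotl
  obtain ⟨hprodρ, hvz⟩ := facsOf_prod_ne_zero f b ρ hρall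
  have hcoord : ∀ i : Fin 4, ∃ c : k, f c = b i := by
    intro i
    by_cases hij : i = j
    · exact ⟨0, by rw [map_zero, hij, hbj]⟩
    · obtain ⟨w, -, hwf⟩ := hall i hij τ hτ ρ hρ
      obtain ⟨hwj, hwi, hwlin, hwfacs, hwzs, hw⟩ := lwitForB_spec hwf
      have hpow := pow_eq_zero_of_lwitB hw f b (by rw [hwj]; exact hbj)
        (fun α hα0 hαq => eval₂Hom_hasseDeriv_eq_zero_of_isEquimultiplePoint f s heq α hα0 hαq)
        (fun zc hzc => hvz zc.1 (hwzs zc hzc))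
      rw [hwi, hwlin, hwfacs] at hpow
      rcases Nat.eq_zero_or_pos w.N with hN0 | hN0
      · rw [hN0, pow_zero] at hpow; exact absurd hpow one_ne_zero
      have hmul := (pow_eq_zero_iff hN0.ne').mp hpow
      rcases mul_eq_zero.mp hmul with h12 | h3
      · rcases mul_eq_zero.mp h12 with h1 | h2
        · exact exists_eq_of_pow_card_eq f (by rw [hN]; exact sub_eq_zero.mp h1)
        · exact absurd h2 hprodτ
      · exact absurd h3 hprodρ
  choose b₀ hb₀ using hcoord
  refine ⟨b₀, ?_, funext fun i => hb₀ i⟩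
  have : f (b₀ j) = f 0 := by rw [hb₀ j, hbj, map_zero]
  exact f.injective this

/-! ## 2. Leaf oracles and the inductive invariant, along `f : k →+* K` -/

/-- **A SOUND LEAF ORACLE over `k`**: whenever it accepts a leaf `ℓ` for the presented state `s` and centre `S`, then over
every field `K` of characteristic `p`, along every `f : k →+* K`, every centre point `b` of chart `ℓ.j` lying ON the leaf gives
a child OUT of coordinate scope. (`k = ZMod p` is res-rescue-typ-3 g9's `LeafSound`.) [folklore] -/
def LeafSoundF (k : Type) [Field k] [DecidableEq k] (p : ℕ) [Fact p.Prime]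
    (leafOK : SData 4 k → Finset (Fin 4) → ILeaf k C → Bool) : Prop :=
  ∀ (s : SData 4 k) (S : Finset (Fin 4)) (ℓ : ILeaf k C), leafOK s S ℓ = true →
    ∀ (K : Type) [Field K] [CharP K p] [DecidableEq K] (f : k →+* K) (b : Fin 4 → K), b ℓ.j = 0 →
      OnLeaf f ℓ b →
        ¬ InCoordinateScope p
          (CentreBlowup.step p S ℓ.j b
            (⟨MvPolynomial.map f s.toState.F, s.toState.r, s.toState.exc⟩ : State K)).F

variable {k : Type} [Field k] [Fintype k] [DecidableEq k]

omit [Fintype k] [DecidableEq k] in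
/-- The state of a row, base-changed along `f`. [folklore] -/
def lrowStateF {K : Type} [Field K] (f : k →+* K) (row : LRow k C) : State K :=
  ⟨MvPolynomial.map f row.1.1.toState.F, row.1.1.toState.r, row.1.1.toState.exc⟩

omit [Fintype k] in
/-- **A good row** over `K`: its state is in-scope escapable, and — if it is a non-blind `p`-fold row — its centre is
permissible and every `K`-edge through its centre leads to an in-scope escapable state. [folklore] -/
def LRowGoodF (p : ℕ) [Fact p.Prime] {K : Type} [Field K] [DecidableEq K] (f : k →+* K) (row : LRow k C) : Prop :=
  InScopeStateWins p (lrowStateF f row) ∧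
    (row.1.2.2 = none → permB p Finset.univ row.1.1.L = true →
      IsPermissibleCentre p row.1.2.1 (lrowStateF f row).F ∧
        ∀ t, Edge p row.1.2.1 (lrowStateF f row) t → InScopeStateWins p t)

/-! ## 3. Soundness of one row, of a certificate -/

/-- The edges through the centre of a MOVE row all lead to in-scope escapable states (𝔽_q edition of `ledges_of_move`).
[folklore] -/
theorem ledges_of_moveF {N : ℕ} (hN : Fintype.card k = N) {p : ℕ} [Fact p.Prime] {K : Type} [Field K] [CharP K p]
    [DecidableEq K] (f : k →+* K) {leafOK : SData 4 k → Finset (Fin 4) → ILeaf k C → Bool}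
    (hs : LeafSoundF k p leafOK) {rest : LCert k C} (hrest : ∀ r ∈ rest, LRowGoodF p f r) {row : LRow k C}
    (hall : lrepliesOKB p rest row.1.1 row.1.2.1 row.2.2.1 row.2.2.2 = true)
    (hflats : lflatsOKB p rest row.1.1 row.1.2.1 row.2.2.1 = true)
    (hleaves : lleavesOKB leafOK row.1.1 row.1.2.1 row.2.2.2 = true)
    (hcov : lcoversOKB N p row.1.1 row.1.2.1 row.2.1 row.2.2.1 row.2.2.2 = true) :
    ∀ t, Edge p row.1.2.1 (lrowStateF f row) t → InScopeStateWins p t := by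
  classical
  unfold lrepliesOKB at hall
  unfold lflatsOKB at hflats
  unfold lleavesOKB at hleaves
  unfold lcoversOKB at hcov
  have hall' := of_decide_eq_true hall
  have hflats' := of_decide_eq_true hflats
  have hleaves' := of_decide_eq_true hleaves
  have hcov' := of_decide_eq_true hcov
  -- a flat of chart `j` absorbs every `K`-point on it
  have hflat : ∀ (j : Fin 4) (φ : Flat k), φ ∈ row.2.2.1 → φ.j = j → ∀ b : Fin 4 → K, OnFlat f φ b →
      InScopeStateWins p (step p row.1.2.1 j b (lrowStateF f row)) := by
    intro j φ hφ hφj b hb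
    obtain ⟨-, -, hbase⟩ := hflats' φ hφ
    obtain ⟨r, hr, hrc, hnone, huniv, hpermr, hdisj⟩ := exists_of_lbaseOK hbase
    obtain ⟨v, hv, rfl⟩ := exists_add_of_onFlat f hb
    have hgood := (hrest r hr).2 hnone huniv
    have hstep : step p row.1.2.1 j (f ∘ φ.b0) (lrowStateF f row) =
        ⟨MvPolynomial.map f (stepD p row.1.2.1 φ.j φ.b0 row.1.1).toState.F,
          (stepD p row.1.2.1 φ.j φ.b0 row.1.1).toState.r, (stepD p row.1.2.1 φ.j φ.b0 row.1.1).toState.exc⟩ := by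
      rw [lrowStateF, ← hφj, BaseChange.step_map f p row.1.2.1 φ.j φ.b0 row.1.1.toState, step_toState]
    have hF : (step p row.1.2.1 j (f ∘ φ.b0) (lrowStateF f row)).F = (lrowStateF f r).F := by
      rw [hstep, lrowStateF, hrc]
    refine inScopeStateWins_step_add_of_move (S' := r.1.2.1) (fun i hi => hv i ?_) ?_ ?_
    · exact fun hiU => (Finset.disjoint_left.mp hdisj) hi hiU
    · rw [hF]; exact hgood.1
    · intro t ht
      obtain ⟨t', ht', hFt⟩ := edge_congr hF ht
      exact inScopeStateWins_congr (hgood.2 t' ht') t hFt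
  -- a leaf of chart `j` gives a blind child at every `K`-point on it
  have hleaf : ∀ (j : Fin 4) (ℓ : ILeaf k C), ℓ ∈ row.2.2.2 → ℓ.j = j → ∀ b : Fin 4 → K, b j = 0 →
      OnLeaf f ℓ b → InScopeStateWins p (step p row.1.2.1 j b (lrowStateF f row)) := by
    intro j ℓ hℓ hℓj b hbj hb
    obtain ⟨-, hok⟩ := hleaves' ℓ hℓ
    refine inScopeStateWins_of_not_inCoordinateScope ?_
    rw [← hℓj]
    exact hs row.1.1 row.1.2.1 ℓ hok K f b (by rw [hℓj]; exact hbj) hb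
  rintro s' ⟨j, b, hj, hbj, heq, hne, rfl⟩
  have h0 : ∀ φ : Flat k, φ ∈ row.2.2.1 → φ.b0 φ.j = 0 := fun φ hφ => (hflats' φ hφ).2.1
  rcases rational_or_onFlat_or_onILeaf_card hN f (hcov' j hj) h0 hbj heq with
    ⟨b₀, hb₀j, rfl⟩ | ⟨φ, hφ, hφj, hon⟩ | ⟨ℓ, hℓ, hℓj, hon⟩
  · -- a rational reply
    rcases hall' j hj b₀ hb₀j with h | ⟨φ, hφ, hφj, honB⟩ | ⟨ℓ, hℓ, hℓj, honB⟩
    · have heq₀ : IsEquimultiplePoint p row.1.2.1 j b₀ row.1.1.toState :=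
        (BaseChange.isEquimultiplePoint_map_ringHom_iff f p row.1.2.1 j b₀ row.1.1.toState).mp heq
      have hstep := BaseChange.step_map f p row.1.2.1 j b₀ row.1.1.toState
      unfold ireplyOK at h
      rw [Bool.or_eq_true, Bool.or_eq_true] at h
      rcases h with (h1 | h2) | h3
      · rw [Bool.not_eq_true', ← Bool.not_eq_true] at h1
        exact absurd ((isEquimultiplePoint_iff p row.1.2.1 j b₀ row.1.1).mp heq₀) h1
      · exfalso
        apply hne
        show (step p row.1.2.1 j (f ∘ b₀) (lrowStateF f row)).F = 0
        rw [lrowStateF, hstep]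
        show MvPolynomial.map f (step p row.1.2.1 j b₀ row.1.1.toState).F = 0
        have hz : (step p row.1.2.1 j b₀ row.1.1.toState).F = 0 := by
          by_contra hnz
          have := (step_F_ne_zero_iff p row.1.2.1 j b₀ row.1.1).mp hnz
          rw [h2] at this
          exact Bool.noConfusion this
        rw [hz, map_zero]
      · obtain ⟨r, hr, hrc⟩ := exists_of_ichildIn h3
        obtain ⟨ur, hur, rfl⟩ := List.mem_map.mp hr
        show InScopeStateWins p (step p row.1.2.1 j (f ∘ b₀) (lrowStateF f row))
        rw [lrowStateF, hstep, step_toState, hrc]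
        exact (hrest ur hur).1
    · exact hflat j φ hφ hφj _ (onFlat_of_onFlatB f honB)
    · exact hleaf j ℓ hℓ hℓj _ (by rw [Function.comp_apply, hb₀j, map_zero]) (onLeaf_of_onLeafBL f honB)
  · exact hflat j φ hφ hφj b hon
  · exact hleaf j ℓ hℓ hℓj b hbj hon

/-- **SOUNDNESS of one row over `K`** (𝔽_q edition of `lrowGood_of_lrowOK`). [folklore] -/
theorem lrowGood_of_lrowOKF {N : ℕ} (hN : Fintype.card k = N) {p : ℕ} [Fact p.Prime] {K : Type} [Field K] [CharP K p]
    [DecidableEq K] (f : k →+* K) {leafOK : SData 4 k → Finset (Fin 4) → ILeaf k C → Bool}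
    (hs : LeafSoundF k p leafOK) {rest : LCert k C} (hrest : ∀ r ∈ rest, LRowGoodF p f r) {row : LRow k C}
    (h : lrowOKL N p leafOK rest row = true) : LRowGoodF p f row := by
  classical
  unfold lrowOKL at h
  rw [Bool.or_eq_true, Bool.or_eq_true] at h
  have hmove : permB p row.1.2.1 row.1.1.L = true →
      lrepliesOKB p rest row.1.1 row.1.2.1 row.2.2.1 row.2.2.2 = true →
      lflatsOKB p rest row.1.1 row.1.2.1 row.2.2.1 = true →
      lleavesOKB leafOK row.1.1 row.1.2.1 row.2.2.2 = true →
      lcoversOKB N p row.1.1 row.1.2.1 row.2.1 row.2.2.1 row.2.2.2 = true →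
      IsPermissibleCentre p row.1.2.1 (lrowStateF f row).F ∧
        ∀ t, Edge p row.1.2.1 (lrowStateF f row) t → InScopeStateWins p t := by
    intro hS hall hflats hleaves hcov
    have hperm : IsPermissibleCentre p row.1.2.1 row.1.1.toState.F :=
      (isPermissibleCentre_iff p row.1.2.1 row.1.1.L).mpr hS
    exact ⟨(BaseChange.isPermissibleCentre_map_iff f p row.1.2.1 _).mpr hperm,
      ledges_of_moveF hN f hs hrest hall hflats hleaves hcov⟩
  rcases h with (hb | ht) | hm
  · -- a monomial-curve blindness certificate: blind over `K`; the second clause is vacuous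
    have hsome : row.1.2.2 ≠ none := by
      unfold lmonoBlindOK at hb
      obtain ⟨⟨s, S, oβ⟩, ws, fl, lv⟩ := row
      rcases oβ with _ | ⟨c, w, α₀, a⟩ | ⟨P, v, D, kk, α₀, a⟩
      · exact absurd hb Bool.false_ne_true
      · exact Option.some_ne_none _
      · exact Option.some_ne_none _
    refine ⟨?_, fun hnone => absurd hnone hsome⟩
    unfold lmonoBlindOK at hb
    obtain ⟨⟨s, S, oβ⟩, ws, fl, lv⟩ := row
    rcases oβ with _ | ⟨c, w, α₀, a⟩ | ⟨P, v, D, kk, α₀, a⟩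
    · exact absurd hb Bool.false_ne_true
    · exact inScopeStateWins_of_not_inCoordinateScope (not_inCoordinateScope_map_of_blindB f hb)
    · exact absurd hb Bool.false_ne_true
  · -- origin not `p`-fold; the second clause is vacuous
    rw [Bool.not_eq_true'] at ht
    constructor
    · refine inScopeStateWins_of_no_permissible fun S hS => ?_
      exact no_permissible_of_not_permB ht S ((BaseChange.isPermissibleCentre_map_iff f p S _).mp hS)
    · intro _ huniv
      rw [ht] at huniv
      exact absurd huniv Bool.false_ne_true
  · simp only [Bool.and_eq_true] at hm
    obtain ⟨⟨⟨⟨hS, hall⟩, hflats⟩, hleaves⟩, hcov⟩ := hm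
    have hm' := hmove hS hall hflats hleaves hcov
    exact ⟨inScopeStateWins_move row.1.2.1 hm'.1 hm'.2, fun _ _ => hm'⟩

/-- **SOUNDNESS OVER EVERY FIELD `K ⊇ k` OF CHARACTERISTIC `p`**: every row of a checked certificate is good over `K`
(𝔽_q edition of `lrowGood_of_lwinCertBL`). [folklore] -/
theorem lrowGood_of_lwinCertBLF {N : ℕ} (hN : Fintype.card k = N) {p : ℕ} [Fact p.Prime] {K : Type} [Field K]
    [CharP K p] [DecidableEq K] (f : k →+* K) {leafOK : SData 4 k → Finset (Fin 4) → ILeaf k C → Bool}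
    (hs : LeafSoundF k p leafOK) :
    ∀ {T : LCert k C}, lwinCertBL N p leafOK T = true → ∀ row ∈ T, LRowGoodF p f row
  | [], _ => fun row hrow => absurd hrow List.not_mem_nil
  | row :: rest, h => by
    unfold lwinCertBL at h
    rw [Bool.and_eq_true] at h
    have hrest := lrowGood_of_lwinCertBLF hN f hs h.2
    intro r hr
    rcases List.mem_cons.mp hr with rfl | hr'
    · exact lrowGood_of_lrowOKF hN f hs hrest h.1
    · exact hrest r hr'

/-- **`∀ K ⊇ k` form**: for a finite coefficient field `k` with `|k| = N`, a SOUND leaf oracle and every field `K` of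
characteristic `p` receiving `k` along `f`, every row state `⊗_f K` of a certificate passing `lwinCertBL N p leafOK` is IN-SCOPE
ESCAPABLE (`InScopeStateWins p`: the F4-C game at `(p, p)`, player B ranging over ALL of `K⁴`). [folklore] -/
theorem forall_inScopeStateWins_of_lwinCertBLF {N : ℕ} (hN : Fintype.card k = N) {p : ℕ} [Fact p.Prime]
    {leafOK : SData 4 k → Finset (Fin 4) → ILeaf k C → Bool} (hs : LeafSoundF k p leafOK)
    {T : LCert k C} (h : lwinCertBL N p leafOK T = true) (K : Type) [Field K] [CharP K p] [DecidableEq K]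
    (f : k →+* K) :
    ∀ row ∈ T, InScopeStateWins p
      (⟨MvPolynomial.map f row.1.1.toState.F, row.1.1.toState.r, row.1.1.toState.exc⟩ : State K) :=
  fun row hrow => (lrowGood_of_lwinCertBLF hN f hs h row hrow).1

end WinCertLeaf

end Summit.ResolutionOfSingularities.ResolutionOfSingularities.Theorems.PIDim4

end
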